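import Summits.AtomisticToContinuum.HydrodynamicLimit.Theses.JParityClosure
import Literature.MathematicalPhysics.KineticTheory.RegularStationaryState
import Literature.MathematicalPhysics.KineticTheory.HardSphereFluxIntensities
import Literature.MathematicalPhysics.KineticTheory.LinearizedEnskogOperator
import Summits.AtomisticToContinuum.HydrodynamicLimit.Theorems.EvenStressEnskog.Negative.ContactValueZero
import Summits.AtomisticToContinuum.HydrodynamicLimit.Theorems.EvenStressEnskog.Negative.PairFunctionalVanishing

/-!
# Line `defect-hierarchy-zero-driving` for crux `JParityClosure.EvenStressEnskog` (stmt-AtomisticToContinuum-13079)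

Skeleton (crux-plan, planner-cruxplan-stmt-AtomisticToContinuum-13079-defect-hierarchy-zer-0, 2026-08-16; idea card
`Cruxes/EvenStressEnskog/Ideas/defect-hierarchy-zero-driving.md`, ideator 2, round 1; triage r1-1/r1-2/r1-3: pass ×3,
sharpenings answered in `Lines/defect-hierarchy-zero-driving.md`). Direction: POSITIVE — `EvenStressEnskog_of` concludes
the crux decl `Summit.AtomisticToContinuum.HydrodynamicLimit.Theses.JParityClosure.EvenStressEnskog` BY NAME from six
registered stubs `stub_*` (the only `sorry`s of the file) and four ROUTE ITEMS cited by name as hypotheses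
(`RateFloor` stmt-13080, `ParityRigidity` stmt-13084, `CollisionTightness` stmt-13085, `HsEosLowDensity` stmt-0768 —
registered obligations of route JParityClosure, admissible by the layer-invariant audit); `EvenStressEnskog_proof` is the
D-0027 §3.3 shape `crux := _of stub₁ … stub₆ items`.

THE LINE (subtract Gibbs; the contact value is a uniqueness theorem, not a computation).  Every local limit of the
Euler-scaled torus gas around a space-time point of the dilute band is a spatially ergodic regular stationary state `ν` of
an infinite hard-sphere flow at unit diameter (`LimitClass`; density of `ν` = local reduced density `σ³ρ`).  The kinetic
half of the route hands over that its one-body velocity law is EXACTLY Maxwellian (`HasMaxwellianVelocityLaw`; here the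
route's parity-free balance node in the crux's own finite-`N` dialect, `LocalVelocityEquilibration`, consumed together with
`RateFloor`/`ParityRigidity` by the local-limit reduction).  Subtracting from `ν` the hard-sphere Gibbs state with the same
`(φ, u, θ)` leaves a DEFECT of correlation functions solving a LINEAR, HOMOGENEOUS, DRIVING-FREE stationary hierarchy
(`δf₁ = 0` empties every source: spectator sources vanish by one-body stationarity, equilibrium-coefficient sources by
`M(v′)M(w′) = M(v)M(w)` — IdeatorTwoSketch.lean, proved), whose same-level part is the slotwise linearised hard-sphere
operator `linearizedEnskogOperator 1 φ u θ` (state independent, symmetric, ≤ 0, gapped: tree) and whose upward couplings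
cost a mean-free-path factor `O(φ)`.  In the dilute clustered class (`IsClustered`: Ruelle bound + integrated tree decay of
the Ursell functions at kinetic range) this hierarchy has TRIVIAL KERNEL below a density `φ_U` — level 2 is the pair
Liouville theorem `PairLiouvilleStatement` (energy method), higher levels an iteration `D = 𝒜ᵏD → 0` with time-ordered
attachments (Klainerman–Machedon combinatorics transplanted) — so `ν` IS the Gibbs state (`stub_defectHierarchyUniqueness`),
its directed-contact statistics are the Stosszahlansatz statistics times the THERMODYNAMIC contact value `Y(φ) = (3/2π)f_ex′(φ)`
(`stub_gibbsContactLaw`: contact/virial theorem + HsEosLowDensity), and the local-limit reduction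
(`stub_localLimitReduction`) turns "every Maxwellian-marginal class state below `φ₀` has the Enskog–Gibbs contact law" into
the crux at threshold `η₀`.  `Y` is never computed: it appears because Gibbs is ONE solution.

REGISTERED STUBS (six; statement `Prop`s `Stubs.stub_*`, sorried theorems `stub_*` with the same text):
* S1 `stub_localLimitReduction`  — TRANSFER `C⁺ ⇒ crux` (XL bookkeeping, shared with every local-limit line of 13078/13079).
* S2 `stub_localVelocityEquilibration` — the route's balance node (kinetic half's output) in finite-`N` form (conditional input).
* S3 `stub_clusterEnvelopes`      — APB: local-limit class states are dilute-clustered (class input; the honest bet B).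
* S4 `stub_pairLiouville`         — level 2: Liouville theorem for the stationary linearised pair equation (M/L, landable).
* S5 `stub_defectHierarchyUniqueness` — UQ: pair Liouville ⇒ clustered Maxwellian-marginal stationary states are Gibbs (XL; HARDEST).
* S6 `stub_gibbsContactLaw`       — CL: dilute Gibbs states have the Enskog–Gibbs contact law with `Y = (3/2π)f_ex′` (L statics).
Composition `EvenStressEnskog_of` (pure logic): constants `(A,C,lam,κ), φ_A` from S3; `φ_U` from S5 fed with S4 and the
constants; `φ_C` from S6 fed with `HsEosLowDensity`; `φ₀ := min φ_A (min φ_U φ_C)` gives `EnskogClassificationAt φ₀`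
(class state → clustered → Gibbs → Enskog contact law); S1 fed with it, S2 and the three route items returns `η₀` with the
crux body `EvenStressEnskogAt η₀`, re-folded into the decl by `evenStressEnskog_iff` (`Iff.rfl`).

CONDITIONALITY (made literal, triage r1-2/r1-3 doubt 1): the line closes 13079 GIVEN the kinetic half — S2 is the route's
declared parity-free node `LocalVelocityEquilibration` (Theses/JParityClosure.lean, TWO-LAYER PLAN: OddToEquilibration =
OddContactSymmetry + EmpiricalEnskogIdentity + CollisionTightness + RateFloor + ParityRigidity → it), wanted by `ParityInBand`
anyway; `RateFloor`, `ParityRigidity`, `CollisionTightness`, `HsEosLowDensity` enter BY NAME.  A refutation of S2 kills the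
ROUTE (kill criteria: "regular stationary non-Gibbs state with non-Maxwellian velocities"), not this line alone.

DISPROOF USED (Cruxes/EvenStressEnskog/Disproof.lean, cycles 1–2, read 2026-08-16T01:50Z): no `_false_without_<H>` theorem
exists (§6.2), so none can be honoured by name; kill target §6.4(b) ("stationary state with Maxwellian one-body law but
non-Enskog J-even contact law") is EXACTLY `¬(S5 ∧ S6)` on the class — the line and the standing adversary attack the same
statement from the two sides; §3/§5 + landed `Negative/ContactValueZero.lean` (`contactValue_zero`, imported, `contactY_zero`
below): `contactY` is read only at the density of a class state, which is POSITIVE (`LimitClass`) and below `φ_C ≤` the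
HsEosLowDensity band (S6), never at `0`; §4 + landed `Negative/PairFunctionalVanishing.lean` (imported) and §9
`SwappedOrderTrivial`: S1 keeps the crux's limit ORDER verbatim (`EvenStressEnskogAt` = the decl body, `∃ r₀ ∀ r < r₀ ∃ N₀`),
local limits are `N → ∞` at FIXED `r`; §8/§10: `EnskogContactLaw` is stated for ALL bounded continuous marks, so the impulse
("frequency") law and the second-moment structure come out as traces, consistent.  Negatives index (`ledger negatives`, 12):
no contact-law / stationary-state / hierarchy statement among them; 9168's unguarded ∀-solution frame and 9236/9238's
small-cell degeneracy are avoided (everything is tied to local limits of the data's own flow, `N → ∞` before `r → 0`).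

VOCABULARY NOTE for the lead: §1–§6 below are TRANSPARENT local definitions over tree objects (`windowContacts`,
`InfiniteHardSphereFlow.traj`, `reflectVel`, `PointConfig.countKernel`, `PointProcess.density`, `RegularStationaryState`,
`IsSpatiallyErgodic`, `IsHardSphereGibbs`, `localMaxwellian`, `hardSphereKernel`, `sphereMeasure`, `linearizedEnskogOperator`,
`hsExcessFreeEnergy`, `Finpartition`); §2 has the SAME bodies as the sibling line
`Cruxes/OddContactSymmetry/Lines/rate-sandwich-isolated-maxwellians.lean` (13078).  Before `--supports` workers can state the
stubs, the block must move to an importable definitions file (precedent: `defn-CollisionTubeFunctional` for 13078's picked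
line) — one file can serve both cruxes.
-/

set_option linter.unusedVariables false

noncomputable section

open scoped BigOperators Topology ENNReal NNReal InnerProductSpace ProbabilityTheory
open MeasureTheory Set Filter Function
open Literature.Analysis.FunctionSpaces Literature.Analysis.FluidPDE
open Literature.MathematicalPhysics.KineticTheory
open Summit.AtomisticToContinuum.HydrodynamicLimit.Theses.JParityClosure

namespace Summit.AtomisticToContinuum.HydrodynamicLimit.Cruxes.EvenStressEnskog.DefectHierarchyZeroDriving

/-! ## §1 The crux with its density threshold exposed -/

/-- The crux WITH ITS THRESHOLD MADE EXPLICIT: `EvenStressEnskog ↔ ∃ η₀ > 0, EvenStressEnskogAt η₀` (body = the route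
decl's, verbatim — same `let`-chain, same limit order `∃ r₀ ∀ r < r₀ ∃ N₀ ∀ N ≥ N₀`; present only so that the transfer
stub S1 can name the threshold it delivers). [folklore] -/
def EvenStressEnskogAt (η₀ : ℝ) : Prop :=
  ∀ (a₀ θ₀ : Literature.MathematicalPhysics.KineticTheory.T3 → ℝ) (u₀ : Literature.MathematicalPhysics.KineticTheory.T3 → Literature.MathematicalPhysics.KineticTheory.V3), Continuous a₀ → Continuous θ₀ → Continuous u₀ → (∀ x, 0 < a₀ x) → (∀ x, 0 < θ₀ x) → ∃ σ₀ : ℝ, 0 < σ₀ ∧ ∀ σ : ℝ, 0 < σ → σ < σ₀ → ∀ Φ : (N : ℕ) → Literature.Analysis.FluidPDE.HardSphereFlow (Literature.Analysis.FluidPDE.Torus.geometry (Fin 3)) (Literature.MathematicalPhysics.KineticTheory.hsDiameter σ N) (N + 1), ∀ τ : ℝ, 0 < τ → ∀ χ : ℝ × UnitAddTorus (Fin 3) → ℝ, Continuous χ → ∀ g : ℝ → ℝ, Continuous g → (∀ a, η₀ ≤ a → g a = 0) → ∀ η δ : ℝ, 0 < η → 0 < δ → ∃ r₀ : ℝ,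 0 < r₀ ∧ ∀ r : ℝ, 0 < r → r < r₀ → ∃ N₀ : ℕ, ∀ N : ℕ, N₀ ≤ N → let ε := Literature.MathematicalPhysics.KineticTheory.hsDiameter σ N; let G := Literature.Analysis.FluidPDE.Torus.geometry (Fin 3); let γ := fun z (s : ℝ) => (Φ N).flow s z; let bx : UnitAddTorus (Fin 3) → UnitAddTorus (Fin 3) → ℝ := fun x y => 3 / (Real.pi * r ^ 3) * max (1 - Literature.Analysis.FluidPDE.Torus.euclidDist x y / r) 0; let ρm := fun z s (x₀ : UnitAddTorus (Fin 3)) => ∫ q, bx q.1 x₀ ∂(Literature.Analysis.FluidPDE.empiricalMeasure (γ z s)); let Θ := fun (Ξ : EuclideanSpace ℝ (Fin 3) × EuclideanSpace ℝ (Fin 3) × EuclideanSpace ℝ (Fin 3) → ℝ) (v w : EuclideanSpace ℝ (Fin 3)) => ∫ ω : Metric.sphere (0 : EuclideanSpace ℝ (Fin 3)) 1, Ξ ((ω : EuclideanSpace ℝ (Fin 3)), v, w) * Literature.MathematicalPhysics.KineticTheory.hardSphereKernel (w, v) ω ∂Literature.MathematicalPhysics.KineticTheory.sphereMeasure; let B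 := fun Ξ z s (x₀ : UnitAddTorus (Fin 3)) => ∫ p, bx p.1.1 x₀ * bx p.2.1 x₀ * Θ Ξ p.1.2 p.2.2 ∂((Literature.Analysis.FluidPDE.empiricalMeasure (γ z s)).prod (Literature.Analysis.FluidPDE.empiricalMeasure (γ z s))); let pv := fun z s (i j : Fin (N + 1)) => Literature.Analysis.FluidPDE.reflectVel (G.sepVec (γ z s i).1 (γ z s j).1) ((γ z s i).2, (γ z s j).2); let Kc := fun (Fn : Literature.Analysis.FluidPDE.Config (N + 1) (Fin 3) Literature.MathematicalPhysics.KineticTheory.T3 → ℝ → Fin (N + 1) → Fin (N + 1) → ℝ) z => ε / (N + 1 : ℝ) * ∑ᶠ (s : ℝ) (_ : s ∈ Literature.Analysis.FluidPDE.collisionTimes G ε (γ z) ∩ Set.Icc 0 τ), ∑ i : Fin (N + 1), ∑ j : Fin (N + 1), (if i ≠ j ∧ ‖G.sepVec (γ z s i).1 (γ z s j).1‖ = ε then Fn z s i j else 0); let Y : ℝ → ℝ := fun a => 3 / (2 * Real.pi) * deriv Literature.MathematicalPhysics.KineticTheory.hsExcessFreeEnergy a; let Dm := fun (Ξ : EuclideanSpace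 ℝ (Fin 3) × EuclideanSpace ℝ (Fin 3) × EuclideanSpace ℝ (Fin 3) → ℝ) z => Kc (fun z s i j => χ (s, (γ z s i).1) * g (σ ^ 3 * ρm z s (γ z s i).1) * Ξ (ε⁻¹ • G.sepVec (γ z s i).1 (γ z s j).1, (pv z s i j).1, (pv z s i j).2)) z - σ ^ 3 * ∫ s in Set.Icc (0 : ℝ) τ, ∫ x : UnitAddTorus (Fin 3), χ (s, x) * g (σ ^ 3 * ρm z s x) * Y (σ ^ 3 * ρm z s x) * B Ξ z s x; let ΞP := fun (k l : Fin 3) (q : EuclideanSpace ℝ (Fin 3) × EuclideanSpace ℝ (Fin 3) × EuclideanSpace ℝ (Fin 3)) => max ⟪q.2.2 - q.2.1, q.1⟫_ℝ 0 * (q.1 k * q.1 l); ∀ k l : Fin 3, Literature.MathematicalPhysics.KineticTheory.localGibbsLaw σ a₀ u₀ θ₀ N (Φ N) {z | η < |Dm (ΞP k l) z|} ≤ ENNReal.ofReal δ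

/-- Definitional bridge (checked by `Iff.rfl`): the crux IS `∃ η₀ > 0, EvenStressEnskogAt η₀`. [folklore] -/
theorem evenStressEnskog_iff : EvenStressEnskog ↔ ∃ η₀ : ℝ, 0 < η₀ ∧ EvenStressEnskogAt η₀ := Iff.rfl

/-- The thermodynamic contact value `Y(a) = (3/2π)·f_ex′(a)` of the route decl (verbatim its `let Y`; honest only on
the OPEN HsEosLowDensity band `(0, η₀)`, where `deriv hsExcessFreeEnergy = F′` — Disproof §3/§5). [folklore] -/
def contactY (a : ℝ) : ℝ := 3 / (2 * Real.pi) * deriv hsExcessFreeEnergy a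

/-- Check against the landed Negative lemma `Negative/ContactValueZero.lean`: the crux's contact value is the junk `0`
AT zero density (physically `Y(0⁺) = 1`).  Every stationary-level statement below reads `contactY` only at the density
of a state of `LimitClass`, which is positive, and S6 restricts to densities below its own `φ_C`. [folklore] -/
theorem contactY_zero : contactY 0 = 0 :=
  Summit.AtomisticToContinuum.HydrodynamicLimit.Theorems.EvenStressEnskog.contactValue_zero

/-! ## §2 Directed-contact statistics of a law of the infinite gas

Transparent abbreviations with the SAME bodies as `Cruxes/OddContactSymmetry/Lines/rate-sandwich-isolated-maxwellians.lean`
§1 (unit diameter: OVY blow-up at the scale of the sphere diameter, so density = reduced density; right-continuous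
velocities, so the incoming pair of a directed contact `(p, q, t)` is `reflectVel (x_p − x_q) (v_p(t), v_q(t))` and marks are
read at `(n̂, v_p⁻, v_q⁻)`, `n̂ = x_p(t) − x_q(t)`, exactly as the crux reads `Ξ (ε⁻¹(x_i − x_j), v_i⁻, v_j⁻)`;
`hardSphereKernel (w, v) n̂ = ((w − v)·n̂)₊ > 0` iff the pair is incoming). -/

/-- Pre-collisional data `(n̂, v_p⁻, v_q⁻)` of a directed contact `c = (p, q, t)` of the paths `x`. [folklore] -/
def preData (x : V3 × V3 → ℝ → V3 × V3) (c : (V3 × V3) × (V3 × V3) × ℝ) : V3 × V3 × V3 :=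
  ((x c.1 c.2.2).1 - (x c.2.1 c.2.2).1,
    (reflectVel ((x c.1 c.2.2).1 - (x c.2.1 c.2.2).1) ((x c.1 c.2.2).2, (x c.2.1 c.2.2).2)).1,
    (reflectVel ((x c.1 c.2.2).1 - (x c.2.1 c.2.2).1) ((x c.1 c.2.2).2, (x c.2.1 c.2.2).2)).2)

/-- Sum of the mark `m (n̂, v⁻, w⁻)` over the directed contacts of the labelled paths `x p`, `p ∈ S`, in the space-time
window `[0,1)³ × [0,1)` (`windowContacts`, finite along hard-sphere trajectories). [folklore] -/
def contactSum (S : Set (V3 × V3)) (x : V3 × V3 → ℝ → V3 × V3) (m : V3 × V3 × V3 → ℝ) : ℝ :=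
  ∑ᶠ c ∈ windowContacts 1 S x, m (preData x c)

/-- The DIRECTED-CONTACT STATISTIC `κ_ν(m)`: mean of `contactSum` under the law `ν` along the flow `Φ` — marks per unit
volume per unit time (Bochner; an honest mean under `ContactRegular`). [folklore] -/
def contactMean (Φ : InfiniteHardSphereFlow (Fin 3) 1) (ν : Measure (PointConfig (V3 × V3)))
    (m : V3 × V3 × V3 → ℝ) : ℝ :=
  ∫ ω, contactSum (ω : Set (V3 × V3)) (Φ.traj ω) m ∂ν

/-- The ONE-BODY VELOCITY LAW `π_ν` (Palm mark law of the particles with position in the unit cube, read off the Campbell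
measure `ν ⊗ₘ countKernel`, normalised by the density). [folklore] -/
def velLaw (ν : Measure (PointConfig (V3 × V3))) : Measure V3 :=
  (PointProcess.density ν)⁻¹ •
    (((ν ⊗ₘ PointConfig.countKernel).restrict {q | q.2.1 ∈ Torus.unitCube (Fin 3)}).map fun q => q.2.2)

/-- Mean velocity of `π_ν`. [folklore] -/
def velMean (ν : Measure (PointConfig (V3 × V3))) : V3 :=
  ∫ v, v ∂velLaw ν

/-- Kinetic temperature of `π_ν`: `θ = ⅓ ∫ |v − u|² dπ_ν`. [folklore] -/
def velTemp (ν : Measure (PointConfig (V3 × V3))) : ℝ :=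
  (∫ v, ‖v - velMean ν‖ ^ 2 ∂velLaw ν) / 3

/-- The STOSSZAHLANSATZ RATE of a mark `Ξ`: `φ² ∫∫∫ Ξ(n̂, v, w) ((w − v)·n̂)₊ dn̂ π_ν(dv) π_ν(dw)` (`φ` = density, unit
diameter) — the local-limit form of the crux's `ρ_r² Θ`-functional `B_r` (Disproof §10: a quadratic form of the local
velocity law). [folklore] -/
def chaosRate (ν : Measure (PointConfig (V3 × V3))) (Ξ : V3 × V3 × V3 → ℝ) : ℝ :=
  (PointProcess.density ν).toReal ^ 2 *
    ∫ v, ∫ w, ∫ ω : Metric.sphere (0 : V3) 1,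
      Ξ ((ω : V3), v, w) * hardSphereKernel (w, v) ω ∂sphereMeasure ∂velLaw ν ∂velLaw ν

/-- CONTACT REGULARITY: bounded continuous marks have `ν`-integrable contact sums. [folklore] -/
def ContactRegular (Φ : InfiniteHardSphereFlow (Fin 3) 1) (ν : Measure (PointConfig (V3 × V3))) : Prop :=
  ∀ m : V3 × V3 × V3 → ℝ, Continuous m → (∀ q, |m q| ≤ 1) →
    Integrable (fun ω : PointConfig (V3 × V3) => contactSum (ω : Set (V3 × V3)) (Φ.traj ω) m) ν

/-! ## §3 The class of local-limit states; Maxwellian marginals; the Enskog–Gibbs contact law -/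

/-- THE CLASS the local-limit reduction (S1) must place the ergodic components of local limits in: spatially ergodic
regular stationary states (`RegularStationaryState`: probability, translation invariant, `Φ`-a.e. defined, `Φ`-stationary,
finite density and kinetic-energy density, entropy-regular w.r.t. a Gibbs state) of an infinite hard-sphere flow at unit
diameter, contact-regular, of POSITIVE density.  Purity (one density per component) is what ergodicity buys; the Gibbs
MIXTURE counterexample to unclustered uniqueness (triage r1-1 §C) is not in the class. [folklore] -/
def LimitClass (Φ : InfiniteHardSphereFlow (Fin 3) 1) (ν : Measure (PointConfig (V3 × V3))) : Prop :=
  RegularStationaryState Φ ν ∧ IsSpatiallyErgodic ν ∧ ContactRegular Φ ν ∧ 0 < PointProcess.density ν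

/-- `δf₁ = 0`: the one-body velocity law of `ν` is EXACTLY a Maxwellian `M_{1,u,θ}`, `θ > 0` (the kinetic half's output on
local limits; S1 derives it for local-limit components from S2 + `RateFloor` + `ParityRigidity`). [folklore] -/
def HasMaxwellianVelocityLaw (ν : Measure (PointConfig (V3 × V3))) : Prop :=
  ∃ θ : ℝ, 0 < θ ∧ ∃ u : V3,
    velLaw ν = (volume : Measure V3).withDensity fun v => ENNReal.ofReal (localMaxwellian 1 θ u v)

/-- THE ENSKOG–GIBBS CONTACT LAW of a state `ν` under `Φ`: for EVERY bounded continuous mark the directed-contact statistic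
is the Stosszahlansatz rate of `ν`'s own one-body law times the thermodynamic contact value at `ν`'s own density,
`κ_ν(Ξ) = Y(φ) · φ² ⟨Ξ ((w−v)·n̂)₊⟩_{π_ν ⊗ π_ν}` — the local-limit form of `K_N[χ g Ξ] ≈ σ³∫∫ χ g Y(σ³ρ_r) B_r(Ξ)`
(all marks, so the impulse law of Disproof §8 and every odd/even component are traces of it). [folklore] -/
def EnskogContactLaw (Φ : InfiniteHardSphereFlow (Fin 3) 1) (ν : Measure (PointConfig (V3 × V3))) : Prop :=
  ∀ Ξ : V3 × V3 × V3 → ℝ, Continuous Ξ → (∀ q, |Ξ q| ≤ 1) →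
    contactMean Φ ν Ξ = contactY (PointProcess.density ν).toReal * chaosRate ν Ξ

/-- `C⁺` at threshold `φ₀` (what S3–S6 jointly deliver and S1 consumes): every state of the class WITH MAXWELLIAN ONE-BODY
LAW and density `< φ₀` has the Enskog–Gibbs contact law. [folklore] -/
def EnskogClassificationAt (φ₀ : ℝ) : Prop :=
  ∀ (Φ : InfiniteHardSphereFlow (Fin 3) 1) (ν : Measure (PointConfig (V3 × V3))),
    LimitClass Φ ν → HasMaxwellianVelocityLaw ν → (PointProcess.density ν).toReal < φ₀ → EnskogContactLaw Φ ν

/-! ## §4 Correlation functions, Ursell functions, the dilute clustered class (APB)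

The card's pointwise envelope `|u_m| ≤ A ρ^m (Cφ)^{m−1} κ^m e^{−L/ℓ}` is FALSE for the Gibbs state itself (on overlapping
arguments `u_m^eq = φ^m Σ_{connected graphs} Π f = (−1)^{m−1}(m−1)! φ^m`; on admissible tight clusters one field vertex
connects up to a kissing number of points at cost `φ`, not `φ^{m−1}`) — triage r1-1 sharpen (1) in sharper form.  The
class is therefore typed in the form the cluster expansion actually delivers for dilute Gibbs states and the iteration of S5
consumes: correlation DENSITIES with a RUELLE BOUND `f_m ≤ (Cφ)^m Π Ĝ_κ(v_i)` (Gaussian velocity envelope at the inflated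
temperature `κθ`, `1 ≤ κ < 2` so that the defect lives in `L²(M⁻¹)`), continuity on the closed admissible set (contact
traces), and INTEGRATED tree decay of the Ursell functions at KINETIC range `ℓ = lam/φ` (every added connected particle costs
`Cφ` after integration; `(m−1)!` from the labelled trees): `∫ |u_{m+1}(z₁, Z′)| e^{φ·maxdist(x₁;X′)/lam} dZ′ ≤ A m! (Cφ)^m φ Ĝ_κ(v₁)`. -/

/-- Campbell sum of `F ≥ 0` over the ordered `m`-tuples of DISTINCT points of the configuration `ω` (an `ℝ≥0∞`-valued
`tsum`: no finiteness junk). [folklore] -/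
def tupleSum (m : ℕ) (ω : PointConfig (V3 × V3)) (F : (Fin m → V3 × V3) → ℝ≥0∞) : ℝ≥0∞ :=
  ∑' Z : {Z : Fin m → V3 × V3 // Function.Injective Z ∧ ∀ k, Z k ∈ (ω : Set (V3 × V3))}, F Z.1

/-- `f m` is the `m`-th CORRELATION FUNCTION of `ν` for every `m` (density of the `m`-th factorial moment measure w.r.t.
Lebesgue measure on phase space `(ℝ³ × ℝ³)^m`): `E_ν Σ_{distinct m-tuples} F = ∫ F f_m` for every measurable `F ≥ 0`
(`∫⁻`, no Bochner junk). [folklore] -/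
def IsCorrelationFamily (ν : Measure (PointConfig (V3 × V3))) (f : (m : ℕ) → (Fin m → V3 × V3) → ℝ) : Prop :=
  ∀ (m : ℕ) (F : (Fin m → V3 × V3) → ℝ≥0∞), Measurable F →
    ∫⁻ ω, tupleSum m ω F ∂ν = ∫⁻ Z, F Z * ENNReal.ofReal (f m Z)

/-- Restriction of an `m`-tuple to a block `B ⊆ Fin m` (increasing enumeration of `B`). [folklore] -/
def restrictTuple {m : ℕ} (Z : Fin m → V3 × V3) (B : Finset (Fin m)) : Fin B.card → V3 × V3 :=
  fun i => Z (B.orderEmbOfFin rfl i)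

/-- URSELL (connected / truncated correlation) FUNCTIONS of a family `f`, by the partition formula
`u_m(Z) = Σ_{π partition of Fin m} (−1)^{|π|−1} (|π|−1)! Π_{B ∈ π} f_{|B|}(Z|_B)` (`u₁ = f₁`, `u₂ = f₂ − f₁⊗f₁`, …;
Mathlib `Finpartition`). [folklore] -/
def ursell (f : (m : ℕ) → (Fin m → V3 × V3) → ℝ) (m : ℕ) (Z : Fin m → V3 × V3) : ℝ :=
  ∑ P : Finpartition (Finset.univ : Finset (Fin m)),
    (-1 : ℝ) ^ (P.parts.card - 1) * ((P.parts.card - 1).factorial : ℝ) *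
      ∏ B ∈ P.parts, f B.card (restrictTuple Z B)

/-- Gaussian velocity envelope of the class: the Maxwellian at `ν`'s own drift and the INFLATED temperature `κ θ_ν`. [folklore] -/
def velEnvelope (κ : ℝ) (ν : Measure (PointConfig (V3 × V3))) (v : V3) : ℝ :=
  localMaxwellian 1 (κ * velTemp ν) (velMean ν) v

/-- THE DILUTE CLUSTERED CLASS (APB) with constants `(A, C, lam, κ)`, `φ :=` density of `ν`: `ν` has correlation functions
of all orders, continuous on the closed admissible sets `{∀ i ≠ j, 1 ≤ |x_i − x_j|}` (so contact traces exist), obeying the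
Ruelle bound `0 ≤ f_m ≤ (Cφ)^m Π_i Ĝ_κ(v_i)` and the integrated tree decay of the Ursell functions at kinetic range
`lam/φ`: `∫ |u_{m+1}(z₁,Z′)| exp(φ · max_i |x′_i − x₁| / lam) dZ′ ≤ A · m! · (Cφ)^m · φ · Ĝ_κ(v₁)` for all `m, z₁`
(`∫⁻`, so a non-integrable Ursell function violates it).  Dilute Gibbs states are in it with `κ = 1`, `lam ≍ φ` (range one
diameter) — cluster expansion; for the unknown stationary state it is the honest class bet "every connection costs an
interaction, at most at kinetic range" (no chaos assumed: velocity correlations are allowed inside the envelopes). [folklore] -/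
def IsClustered (A C lam κ : ℝ) (ν : Measure (PointConfig (V3 × V3))) : Prop :=
  ∃ f : (m : ℕ) → (Fin m → V3 × V3) → ℝ, IsCorrelationFamily ν f ∧
    (∀ m, ContinuousOn (f m) {Z | ∀ i j, i ≠ j → 1 ≤ ‖(Z i).1 - (Z j).1‖}) ∧
    (∀ (m : ℕ) (Z : Fin m → V3 × V3), 0 ≤ f m Z ∧
      f m Z ≤ (C * (PointProcess.density ν).toReal) ^ m * ∏ i, velEnvelope κ ν (Z i).2) ∧
    (∀ (m : ℕ) (z₁ : V3 × V3),
      ∫⁻ Z : Fin m → V3 × V3, ENNReal.ofReal (|ursell f (m + 1) (Fin.cons z₁ Z)| *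
          Real.exp ((PointProcess.density ν).toReal * (⨆ i, ‖(Z i).1 - z₁.1‖) / lam)) ≤
        ENNReal.ofReal (A * m.factorial * (C * (PointProcess.density ν).toReal) ^ m *
          (PointProcess.density ν).toReal * velEnvelope κ ν z₁.2))

/-! ## §5 Level 2 of the defect hierarchy: the stationary linearised PAIR equation -/

/-- PAIR LIOUVILLE STATEMENT (the card's first lemma, typed as triage asked: RELATIVE coordinate `r = x₁ − x₂`, `θ > 0`,
hard core `|r| ≥ 1` with the SPECULAR (elastic-reflection) boundary condition at `|r| = 1`, weighted-`L²` integrability).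
For density `φ > 0`, temperature `θ > 0`, drift `u`: a pair defect `h(r)(v₁,v₂)` (relative to `M(v₁)M(v₂)`), continuous on
the closed exterior domain, differentiable in `r` on the open one, of Gaussian growth strictly below `e^{|v−u|²/(4θ)}` in each
velocity (so every collision integral converges absolutely and `h ∈ L²(MM_*)` fibrewise), with
`(1 + |v₁| + |v₂|) h² M M_*` integrable over `{|r| ≥ 1} × ℝ⁶`, reflection-invariant at contact
(`h(n̂)(v₁′,v₂′) = h(n̂)(v₁,v₂)`), and solving `(v₁ − v₂)·∇_r h = 𝓛♭⁽¹⁾h + 𝓛♭⁽²⁾h` on `|r| > 1` (slotwise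
`linearizedEnskogOperator 1 φ u θ`), VANISHES on `|r| ≥ 1`.  Energy method: transport is antisymmetric and its flux through
`|r| = 1` vanishes by the reflection symmetry (`MM_*` and `h` invariant, `(v₁−v₂)·n̂` odd); `−⟨h,(𝓛⁽¹⁾+𝓛⁽²⁾)h⟩ ≥ 0` with
equality iff `h` is fibrewise in the 25-dimensional span of slotwise collision invariants; transport then forces
constant/Killing coefficients, which the `L²` condition kills on the connected exterior domain. [folklore] -/
def PairLiouvilleStatement : Prop :=
  ∀ (φ θ : ℝ) (u : V3), 0 < φ → 0 < θ →
  ∀ h : V3 → V3 × V3 → ℝ,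
    ContinuousOn (Function.uncurry h) ({r : V3 | 1 ≤ ‖r‖} ×ˢ Set.univ) →
    (∀ V : V3 × V3, DifferentiableOn ℝ (fun r => h r V) {r : V3 | 1 < ‖r‖}) →
    (∃ a K : ℝ, a < 1 / (4 * θ) ∧ ∀ r V, |h r V| ≤ K * Real.exp (a * (‖V.1 - u‖ ^ 2 + ‖V.2 - u‖ ^ 2))) →
    Integrable (fun p : V3 × (V3 × V3) =>
        (1 + ‖p.2.1‖ + ‖p.2.2‖) * h p.1 p.2 ^ 2 * (localMaxwellian 1 θ u p.2.1 * localMaxwellian 1 θ u p.2.2))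
      (((volume : Measure V3).restrict {r : V3 | 1 ≤ ‖r‖}).prod (volume : Measure (V3 × V3))) →
    (∀ (n : V3) (V : V3 × V3), ‖n‖ = 1 → h n (reflectVel n V) = h n V) →
    (∀ (r : V3) (V : V3 × V3), 1 < ‖r‖ →
      fderiv ℝ (fun r' => h r' V) r (V.1 - V.2) =
        linearizedEnskogOperator 1 φ u θ (fun v₁ => h r (v₁, V.2)) V.1 +
          linearizedEnskogOperator 1 φ u θ (fun v₂ => h r (V.1, v₂)) V.2) →
    ∀ (r : V3) (V : V3 × V3), 1 ≤ ‖r‖ → h r V = 0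

/-! ## §6 The kinetic half's output in the crux's own finite-`N` dialect -/

/-- LOCAL VELOCITY EQUILIBRATION — the route's parity-free balance node ("EvenProductionVanishes", Theses/JParityClosure.lean
TWO-LAYER PLAN), in the dialect of `OddContactSymmetry` (same profiles, flows, mollifiers `bx`, `ρm`, `hm`, surprisal jump
`F = log[h(v⁻)h(w⁻)/(h(v⁺)h(w⁺))]`, functional `K_N`): the TRUNCATED EVEN PRODUCTION of the collision measure,
`K_N[χ g(σ³ρ_r) min(F(1 − e^{−F}), L)]` (`F(1−e^{−F}) ≥ 0` termwise), tends to `0` in probability for every truncation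
level `L > 0` (`N → ∞` at fixed `r, ϑ < r₀(L, η, δ)`).  Truncation makes the functional `≤ L·K_N[χ g]`, immune to the
self-spike non-tightness of `e^{−F}` flagged by the 13078 lead (PICKED.md, 2026-08-16), and costs nothing in the limit
(monotone in `L`).  Limit content: the even production of every local one-body law against the limit contact law
vanishes; with `RateFloor` and `ParityRigidity` the local law is a Maxwellian (point masses are not entropy-regular). [folklore] -/
def LocalVelocityEquilibration : Prop :=
  ∃ η₀ : ℝ, 0 < η₀ ∧ ∀ (a₀ θ₀ : T3 → ℝ) (u₀ : T3 → V3), Continuous a₀ → Continuous θ₀ → Continuous u₀ → (∀ x, 0 < a₀ x) → (∀ x, 0 < θ₀ x) → ∃ σ₀ : ℝ, 0 < σ₀ ∧ ∀ σ : ℝ, 0 < σ → σ < σ₀ → ∀ Φ : (N : ℕ) → HardSphereFlow (Torus.geometry (Fin 3)) (hsDiameter σ N) (N + 1), ∀ τ : ℝ, 0 < τ → ∀ χ : ℝ × UnitAddTorus (Fin 3) → ℝ, Continuous χ → ∀ g : ℝ → ℝ, Continuous g → (∀ a, η₀ ≤ a → g a = 0) → ∀ L : ℝ, 0 < L → ∀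 η δ : ℝ, 0 < η → 0 < δ → ∃ r₀ : ℝ, 0 < r₀ ∧ ∀ r ϑ : ℝ, 0 < r → r < r₀ → 0 < ϑ → ϑ < r₀ → ∃ N₀ : ℕ, ∀ N : ℕ, N₀ ≤ N → let ε := hsDiameter σ N; let G := Torus.geometry (Fin 3); let γ := fun z (s : ℝ) => (Φ N).flow s z; let bx : UnitAddTorus (Fin 3) → UnitAddTorus (Fin 3) → ℝ := fun x y => 3 / (Real.pi * r ^ 3) * max (1 - Torus.euclidDist x y / r) 0; let ρm := fun z s (x₀ : UnitAddTorus (Fin 3)) => ∫ q, bx q.1 x₀ ∂(empiricalMeasure (γ z s)); let hm := fun z s (x₀ : UnitAddTorus (Fin 3)) (v : EuclideanSpace ℝ (Fin 3)) => ∫ q, bx q.1 x₀ * localMaxwellian 1 (ϑ ^ 2) v q.2 ∂(empiricalMeasure (γ z s)); let pv := fun z s (i j : Fin (N + 1)) => reflectVel (G.sepVec (γ z s i).1 (γ z s j).1) ((γ z s i).2, (γ z s j).2); let F := fun z s (i j : Fin (N + 1)) => Real.log (hm z s (γ z s i).1 (pv z s i j).1) + Real.log (hm z s (γ z s i).1 (pv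 z s i j).2) - Real.log (hm z s (γ z s i).1 (γ z s i).2) - Real.log (hm z s (γ z s i).1 (γ z s j).2); let Kc := fun (Fn : Config (N + 1) (Fin 3) T3 → ℝ → Fin (N + 1) → Fin (N + 1) → ℝ) z => ε / (N + 1 : ℝ) * ∑ᶠ (s : ℝ) (_ : s ∈ collisionTimes G ε (γ z) ∩ Set.Icc 0 τ), ∑ i : Fin (N + 1), ∑ j : Fin (N + 1), (if i ≠ j ∧ ‖G.sepVec (γ z s i).1 (γ z s j).1‖ = ε then Fn z s i j else 0); let D := fun z => Kc (fun z s i j => χ (s, (γ z s i).1) * g (σ ^ 3 * ρm z s (γ z s i).1) * min (F z s i j * (1 - Real.exp (-F z s i j))) L) z; localGibbsLaw σ a₀ u₀ θ₀ N (Φ N) {z | η < |D z|} ≤ ENNReal.ofReal δ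

/-! ## §7 The registered stubs -/

/-- **S1 · LOCAL-LIMIT REDUCTION** (`stub_localLimitReduction`; the transfer `C⁺ ⇒ crux`; XL bookkeeping, no new
mechanism; shared in substance with stub E of 13078's rate-sandwich line and with every local-limit card of this crux).
If every Maxwellian-marginal state of the class below density `φ₀` has the Enskog–Gibbs contact law, and the kinetic half
holds in the form `LocalVelocityEquilibration` + `RateFloor` + `ParityRigidity`, then the crux body holds at some threshold
`η₀ > 0` (intended `η₀ = φ₀`), given `CollisionTightness` (tightness of every `K_N[·]`) and `HsEosLowDensity` (continuity of
`Y` on the OPEN band, Disproof §3/§5).  Intended proof, per profiles and `σ` small, in the crux's limit order (`N → ∞` at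
fixed `r`, then `r → 0`; Disproof §4/§9): (i) tightness of the `χ·g(σ³ρ_r)`-weighted space-time averages of the blown-up
laws (`blowUp` at scale `ε_N = hsDiameter σ N`; energy conservation, CollisionTightness) and their limits: translation
invariant (averaging in `x` at scale `r ≫ ε`), stationary (macroscopic time = `ε⁻¹ ×` microscopic, OVY 1993 Lemma 4.1),
entropy-regular (relative entropy w.r.t. the invariant Gibbs law is CONSERVED by the flow and `≤ CN` at `t = 0`), of finite
density/energy, carried by Alexander-regular configurations so that an `InfiniteHardSphereFlow (Fin 3) 1` is a.e. defined
and stationary for them (Alexander 1976 Thm 5.2/5.3), contact-regular (finite contact intensity ⇐ CollisionTightness);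
(ii) ergodic decomposition into members of `LimitClass`, density of the components = the local reduced density
`σ³ρ(s,x) < η₀` (PURITY at scale `r`: automatic at Lebesgue points of strong limits, i.e. pre-shock; for the filed `∀ τ`
it is the "no sub-`r` texture / no dense pockets" input of triage remark R — THIS STUB CARRIES IT, see why-it-might-fail);
(iii) the one-body law of a.e. component is Maxwellian: `LocalVelocityEquilibration` gives vanishing truncated even
production of the limit contact law, `RateFloor` compares it with the ideal kernel, `ParityRigidity` (collision-invariant
rigidity) leaves point mass or Maxwellian, entropy-regularity excludes point masses; (iv) identification of the `N → ∞`
limit of `K_N[χ g Ξ_P^{kl}]` at fixed `r` with `∫∫ χ g(φ) σ⁻³ κ_{ν_{s,x}}(Ξ_P^{kl}) dx ds` (directed contacts counted through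
pre-collision tubes, continuous one-time functionals, as in 13078's `stub_cylinderPullback`) and of the Enskog side with
`∫∫ χ g(φ) σ⁻³ Y(φ) chaosRate(Ξ_P^{kl})` (`B_r → ρ_r²⟨Θ⟩`, Disproof §10; `(N+1)ε³ = σ³`), equal by `EnskogContactLaw`;
(v) `r → 0` at Lebesgue points, in-probability form via Young measures over the randomness of the limit.  Why it might
fail: a deterministic local ergodic decomposition with the listed regularity is unproved for hard spheres; post-shock
(`∀ τ`) sub-`r` density/velocity texture of local limits would break purity (route-level fix recommended: restrict the
crux to `τ < T`, Disproof §6.5).  Leans on: `blowUp`, `ovyLaplace`, `IsOVYLimitState`, `RegularStationaryState`,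
`PointProcess.IsVagueClusterPoint`, `windowContacts_finite`, `localGibbsLaw`, `HardSphereFlow.measurePreserving`,
`InfiniteHardSphereFlow.nonempty/unique` (named facts), `IsCollisionInvariant.exists_eq_quadratic_holds`; route items
13080/13084/13085/0768 by name; OllaVaradhanYau1993 §4, Spohn1991 I.2.4, Alexander1976, Kallenberg2021 Thm 16.16. [size XL] -/
def Stubs.stub_localLimitReduction : Prop :=
  ∀ φ₀ : ℝ, 0 < φ₀ → EnskogClassificationAt φ₀ → LocalVelocityEquilibration → RateFloor → ParityRigidity →
    CollisionTightness → HsEosLowDensity → ∃ η₀ : ℝ, 0 < η₀ ∧ EvenStressEnskogAt η₀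

/-- Registered stub S1 (`Stubs.stub_localLimitReduction`, verbatim): the `sorry` to be discharged. -/
theorem stub_localLimitReduction :
    ∀ φ₀ : ℝ, 0 < φ₀ → EnskogClassificationAt φ₀ → LocalVelocityEquilibration → RateFloor → ParityRigidity →
      CollisionTightness → HsEosLowDensity → ∃ η₀ : ℝ, 0 < η₀ ∧ EvenStressEnskogAt η₀ := by
  sorry

/-- **S2 · LOCAL VELOCITY EQUILIBRATION** (`stub_localVelocityEquilibration`; CONDITIONAL INPUT = the kinetic half's output,
the route's declared parity-free node, NOT this line's mechanism).  Statement: `LocalVelocityEquilibration` (§6).  Why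
plausibly true: it is local equilibrium of the ONE-body law at Euler scaling (`Kn ≍ N^{-1/3} → 0` at fixed reduced
density), exactly what the kinetic chain of the route delivers — `EmpiricalEnskogIdentity` (free collisional balance,
`K_N[χ g F] → 0`) + `OddContactSymmetry` (13078, `K_N[χ g F(1+e^{−F})] → 0` after truncation/tails) give
`K_N[χ g F(1−e^{−F})] → 0`, i.e. the node OddToEquilibration of `ParityInBand`; at rung 0 (constant profiles, Gibbs law
invariant) `hm → ρ M_{θ+ϑ²}` by the r-ball LLN and `F → 0` identically.  Why it might fail: a forward local-Gibbs evolution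
sustaining a non-Maxwellian local velocity law on a set of positive space-time measure (kills the whole route: kill
criteria); the self-spike of `hm` at the fastest particles is neutralised by the truncation `min(·, L)`.  Leans on: route
items 13078, 13083, 13086, 13085, 13087 (as the route's glue does); tree `localGibbs_lln`, `integral_empiricalMeasure`,
`IsHardSphereTrajectory.numCollisions_eq`; CIP1994 §3.2, Spohn1991 I.3, OllaVaradhanYau1993. [size XL / open — shared with 13078] -/
def Stubs.stub_localVelocityEquilibration : Prop :=
  LocalVelocityEquilibration

/-- Registered stub S2 (`Stubs.stub_localVelocityEquilibration`): the `sorry` to be discharged (by the kinetic half). -/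
theorem stub_localVelocityEquilibration : LocalVelocityEquilibration := by
  sorry

/-- **S3 · CLUSTER ENVELOPES (APB)** (`stub_clusterEnvelopes`; the class input — triage r1-2: "(APB)-membership as an explicit
stub, not part of the class").  There are constants `A, C, lam > 0` and a temperature inflation `1 ≤ κ < 2` and a density
`φ_A > 0` such that every state of `LimitClass` with Maxwellian one-body law and density `< φ_A` is in the dilute clustered
class `IsClustered A C lam κ` (§4).  Why plausibly true: for the Gibbs state it is the convergent low-density cluster
expansion of the hard-sphere gas (Ruelle bound `ρ_m ≤ z^m`, tree-graph bounds, range one diameter; `κ = 1`); for a dilute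
stationary state "every connection costs an interaction": connected `(m+1)`-point correlations are built by collision
sequences, each costing a factor `φ` after integration over the added particle and surviving at most a few mean free paths
`lam/φ` (kinetic range ALLOWED, no chaos smuggled: velocity correlations live inside the envelopes); Gaussian velocity
envelopes are the stationary form of the route's `KineticEnergyTails` input.  Why it might fail: long-range (algebraic)
equal-time correlations of a non-equilibrium stationary state (Dorfman–Kirkpatrick–Sengers) — known only as RESPONSES to
gradients, absent here by translation invariance and Maxwellian marginal, but not excluded a priori; or velocity tails fatter
than `M_{2θ}` in the pair sector.  Leans on: `HardCoreUrsell` / `HardCoreCanonical` (Mayer/tree bounds, eq side),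
`RegularStationaryState.regular` (entropy regularity ⇒ local absolute continuity), Ruelle1969 §4, LebowitzPenrose1964,
GST2013 Part II (dynamical cluster/tree expansions), Spohn1991 §2.4. [size L/XL — the class bet] -/
def Stubs.stub_clusterEnvelopes : Prop :=
  ∃ A C lam κ : ℝ, 1 ≤ κ ∧ κ < 2 ∧ 0 < lam ∧ ∃ φA : ℝ, 0 < φA ∧
    ∀ (Φ : InfiniteHardSphereFlow (Fin 3) 1) (ν : Measure (PointConfig (V3 × V3))),
      LimitClass Φ ν → HasMaxwellianVelocityLaw ν → (PointProcess.density ν).toReal < φA → IsClustered A C lam κ ν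

/-- Registered stub S3 (`Stubs.stub_clusterEnvelopes`, verbatim): the `sorry` to be discharged. -/
theorem stub_clusterEnvelopes :
    ∃ A C lam κ : ℝ, 1 ≤ κ ∧ κ < 2 ∧ 0 < lam ∧ ∃ φA : ℝ, 0 < φA ∧
      ∀ (Φ : InfiniteHardSphereFlow (Fin 3) 1) (ν : Measure (PointConfig (V3 × V3))),
        LimitClass Φ ν → HasMaxwellianVelocityLaw ν → (PointProcess.density ν).toReal < φA →
          IsClustered A C lam κ ν := by
  sorry

/-- **S4 · PAIR LIOUVILLE THEOREM** (`stub_pairLiouville`; level 2 of the defect hierarchy; provable now, M/L).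
Statement: `PairLiouvilleStatement` (§5).  Why true: the energy method sketched in §5 — `HardSphereFlow`-free pure
analysis over `linearizedEnskogOperator` (symmetry `localMaxwellianInner_linearizedEnskogOperator_comm`, non-positivity
`…_self_nonpos`, kernel `linearizedEnskogOperator_eq_zero_iff`, gap `linearizedEnskogOperator_spectralGap` — stated in the
tree on `temperateGrowth`; the prover extends the quadratic-form facts to the Gaussian-weighted `L²(M)` class of the
statement, CIP1994 §7.1–7.2, the `L²` theory being the published one), divergence theorem on the exterior domain with the
specular flux cancellation (`reflectVel` preserves `MM_*`, flips `(v₁−v₂)·n̂`), and the Killing-type classification of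
transport-invariant elements of the invariant fibre (triage r1-1 §C, r1-3 §C: only non-decaying solutions).  No decaying
zero mode exists among separable/hydrodynamic ansätze (card falsifier (1), checked by triage).  Why it might fail AS TYPED:
a technical gap between pointwise differentiability in `r` and the `W^{1,1}` chain rule for `h²` (repair: add the missing
regularity hypothesis — the lead reshapes); the true level-2 operator of the hierarchy differs from the one here inside
`1 ≤ |r| ≤ 2` by Enskog's one-diameter offset (`linearizedEnskogOperatorDeloc`) and the shielding truncation of triage
r1-1 sharpen (1), both symmetric non-positive modifications (first reshape candidate if S5's proof wants them literally).
Leans on: the tree names above, `reflectVel_eq_collide`, `norm_sq_collide_fst_add_norm_sq_collide_snd`,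
`IdeatorTwo.localMaxwellian_collide_mul`; Case 1972 doi:10.1063/1.1693919, Garbanati–Greenberg–Zweifel 1978
doi:10.1063/1.523545 (one-particle analogues). [size M/L — landable] -/
def Stubs.stub_pairLiouville : Prop :=
  PairLiouvilleStatement

/-- Registered stub S4 (`Stubs.stub_pairLiouville`): the `sorry` to be discharged. -/
theorem stub_pairLiouville : PairLiouvilleStatement := by
  sorry

/-- **S5 · DEFECT-HIERARCHY UNIQUENESS (UQ)** (`stub_defectHierarchyUniqueness`; THE BET, hardest, load-bearing; consumes S4).
Given the pair Liouville theorem: for all class constants `(A, C, lam, κ)` with `1 ≤ κ < 2`, `lam > 0` there is `φ_U > 0`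
such that every state of `LimitClass` with Maxwellian one-body law, in `IsClustered A C lam κ`, of density `< φ_U`, IS a
hard-sphere Gibbs state (`IsHardSphereGibbs 1 z β u ν` for some activity `z > 0`, inverse temperature `β > 0`, drift `u`).
Intended proof (the card's engine): (1) the correlation functions of a regular stationary state solve the stationary
hard-sphere BBGKY hierarchy weakly with the elastic-reflection boundary condition and contact traces (infinite-volume
Bogolyubov identities from `Φ`-stationarity; finite-`N` model `bbgky_hierarchy_of_liouville`); (2) subtract the Gibbs family
with the same `(φ, u, θ)` (`HardCoreCanonical`/`gibbsSpec` side): the Ursell DEFECTS `δu_m` solve a linear homogeneous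
hierarchy with `δu₁ = 0`, spectator sources `= 0` by one-body stationarity of both states, eq-coefficient sources reduced by
`M′M′_* = MM_*` to compactly supported configurational kernels (IdeatorTwoSketch: `spectator_source_vanishes`,
`localMaxwellian_collide_mul`, `defect_level2_collision_term` — the same-level operator is slotwise
`linearizedEnskogOperator 1 φ u θ`, state independent); (3) level 2 = S4's equation with source `C[δu₃]` (RUNG 1, the lead's
first milestone: in the velocity-factorised sector `f_m = ρ_m ΠM` the system is the hard-core BGY-difference hierarchy and
uniqueness is Kirkwood–Salsburg-type contraction by direct integration — the case Genovese–Simonella 2012 call "the only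
relevant case left open"); (4) the `|g|`-weighted level-2 a-priori bound `|δu₂|/(φ²MM_*) ≤ Cφ(1 + √θ/|v₁−v₂|)·‖δu₃‖`
(zero-frequency pair resolvent in `d = 3`; triage r1-3 sharpen (b)); (5) all orders: `D = 𝒜ᵏD → 0` in the weighted norm of
the class, the Duhamel/attachment factorials beaten by time-ordering inside connectedness windows (Klainerman–Machedon
2008 doi:10.1007/s00220-008-0426-4, Chen–Holmer doi:10.4171/jems/610 board game, transplanted: free propagator ↦
`(transport − Σ𝓛⁽ᵏ⁾)⁻¹` at zero frequency, Sobolev a-priori bounds ↦ `IsClustered`); (6) `δu = 0` ⇒ correlation functions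
Gibbs ⇒ `ν` Gibbs (Ruelle bound ⇒ the factorial moments determine the law).  Why it might fail: a neutral (decaying,
non-Gibbs) zero mode of the linearised stationary hierarchy at some level `≥ 3` inside the class — S4 excludes level 2;
the combinatorial bound of (5) is the research problem (NoDensityExpansionBarrierNarrow scope (A): resummed zero-frequency
objects at fixed `φ`, not blocked; Cohen's "complete resummation" caveat is the bet); BoltzmannHypothesisBarrierNarrow
scope (b) (absence of proof) is what this stub would lift, by a NEW partial classification (Maxwellian marginal + dilute
clustering, not velocity independence as in OVY, not a Gibbs-type ansatz as in Gurevich–Suhov).  Leans on: S4;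
`linearizedEnskogOperator*`, `hardSphereLinearizedOp_spectralGap_holds`, `HardSphereBBGKY.bbgky_hierarchy_of_liouville`,
`bbgky_duhamel_expansion`, `HardSphereMildBBGKY*`, `IsHardSphereGibbs`/`gibbsSpec`, `HardCoreUrsell`; CIP1994 §4,
GST2013 Part II, Spohn1991 §2.4/§4, Gurevich–Suhov doi:10.1007/bf01608637, Genovese–Simonella doi:10.1007/s10955-012-0525-7,
Ravech–Stuart doi:10.1007/bf01014401. [size XL — open; HARDEST] -/
def Stubs.stub_defectHierarchyUniqueness : Prop :=
  PairLiouvilleStatement → ∀ A C lam κ : ℝ, 1 ≤ κ → κ < 2 → 0 < lam → ∃ φU : ℝ, 0 < φU ∧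
    ∀ (Φ : InfiniteHardSphereFlow (Fin 3) 1) (ν : Measure (PointConfig (V3 × V3))),
      LimitClass Φ ν → HasMaxwellianVelocityLaw ν → IsClustered A C lam κ ν →
        (PointProcess.density ν).toReal < φU →
        ∃ z β : ℝ, ∃ u : V3, 0 < z ∧ 0 < β ∧ IsHardSphereGibbs 1 z β u ν

/-- Registered stub S5 (`Stubs.stub_defectHierarchyUniqueness`, verbatim): the `sorry` to be discharged. -/
theorem stub_defectHierarchyUniqueness :
    PairLiouvilleStatement → ∀ A C lam κ : ℝ, 1 ≤ κ → κ < 2 → 0 < lam → ∃ φU : ℝ, 0 < φU ∧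
      ∀ (Φ : InfiniteHardSphereFlow (Fin 3) 1) (ν : Measure (PointConfig (V3 × V3))),
        LimitClass Φ ν → HasMaxwellianVelocityLaw ν → IsClustered A C lam κ ν →
          (PointProcess.density ν).toReal < φU →
          ∃ z β : ℝ, ∃ u : V3, 0 < z ∧ 0 < β ∧ IsHardSphereGibbs 1 z β u ν := by
  sorry

/-- **S6 · GIBBS CONTACT LAW (CL)** (`stub_gibbsContactLaw`; statics, L; where `Y` enters — as the contact value of the ONE
known solution).  Given `HsEosLowDensity`: there is `φ_C > 0` (at most its band edge) such that every state of `LimitClass`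
that is a hard-sphere Gibbs state of density `< φ_C` has the Enskog–Gibbs contact law `EnskogContactLaw` with
`Y(φ) = (3/2π)·deriv hsExcessFreeEnergy φ`.  Intended proof: (i) flux/Palm identity for a stationary state with continuous
two-point function up to contact: `κ_ν(Ξ) = ∫dn̂ ∫∫ ((w−v)·n̂)₊ Ξ(n̂,v,w) f₂(x, v; x − n̂, w) dv dw` (directed contacts in
`[0,1)` counted through thin pre-collision tubes along the trajectories `Φ.traj`, `windowContacts_finite`; unit cube, unit
time); (ii) for the Gibbs state `f₂ = ρ₂(x₁,x₂) M_θ(v)M_θ(w)` with `ρ₂(1⁺) = φ² g(1⁺)` and the velocity law IS `π_ν = M_θ`,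
so `κ_ν(Ξ) = g(1⁺)·chaosRate ν Ξ`; (iii) the contact/virial theorem for the infinite-volume hard-sphere Gibbs state,
`Z = p/(φθ) = 1 + (2π/3) φ g(1⁺)`, and the equation of state `Z = 1 + φ f_ex′(φ)` on the OPEN analyticity band of
`HsEosLowDensity` (equivalence of the grand-canonical pressure with the canonical `hsExcessFreeEnergy`, low-density cluster
expansion) give `g(1⁺) = (3/2π) f_ex′(φ) = contactY φ` (the crux-attack report's audited normalisation, Disproof §7 cycle 2:
`Y = χ_c`); (iv) identification of `(z, β, u)` with `(φ, θ⁻¹, velMean)` (the Gibbs one-body law is `φ·M`).  `contactY` is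
never read at `0` (`φ > 0` in the class; `contactY_zero`).  Why it might fail: only through the dynamics entering `κ_ν` — a
junk `InfiniteHardSphereFlow` stationary for `ν` but tracking non-regular solutions; excluded a.e. by Alexander's
uniqueness class (named fact `InfiniteHardSphereFlow.unique`, to be carried as a hypothesis if needed).  Leans on:
`IsHardSphereGibbs`, `gibbsSpec`, `windowContacts`, `contactImpulse`-style contact kinematics, `HardCoreCanonical`,
`hsExcessFreeEnergy`/`hsCompressibility`, route item 0768; Ruelle1969 §3.4/§4, LebowitzPenrose1964, Spohn1991 I (3.15)–(3.17),
Chapman–Cowling Ch. 16 (`Y = χ`). [size L — landable] -/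
def Stubs.stub_gibbsContactLaw : Prop :=
  HsEosLowDensity → ∃ φC : ℝ, 0 < φC ∧
    ∀ (Φ : InfiniteHardSphereFlow (Fin 3) 1) (ν : Measure (PointConfig (V3 × V3))),
      LimitClass Φ ν → (∃ z β : ℝ, ∃ u : V3, 0 < z ∧ 0 < β ∧ IsHardSphereGibbs 1 z β u ν) →
        (PointProcess.density ν).toReal < φC → EnskogContactLaw Φ ν

/-- Registered stub S6 (`Stubs.stub_gibbsContactLaw`, verbatim): the `sorry` to be discharged. -/
theorem stub_gibbsContactLaw :
    HsEosLowDensity → ∃ φC : ℝ, 0 < φC ∧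
      ∀ (Φ : InfiniteHardSphereFlow (Fin 3) 1) (ν : Measure (PointConfig (V3 × V3))),
        LimitClass Φ ν → (∃ z β : ℝ, ∃ u : V3, 0 < z ∧ 0 < β ∧ IsHardSphereGibbs 1 z β u ν) →
          (PointProcess.density ν).toReal < φC → EnskogContactLaw Φ ν := by
  sorry

/-! ## §8 The composition (kernel-checked, sorry-free) -/

/-- `C⁺` from S3–S6 and `HsEosLowDensity`: below `φ₀ := min φ_A (min φ_U φ_C)` every Maxwellian-marginal class state is
clustered (S3), hence Gibbs (S5 fed with S4), hence has the Enskog–Gibbs contact law (S6). [folklore] -/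
theorem enskogClassification_of (hAPB : Stubs.stub_clusterEnvelopes) (hPL : Stubs.stub_pairLiouville)
    (hUQ : Stubs.stub_defectHierarchyUniqueness) (hCL : Stubs.stub_gibbsContactLaw) (s₆ : HsEosLowDensity) :
    ∃ φ₀ : ℝ, 0 < φ₀ ∧ EnskogClassificationAt φ₀ := by
  obtain ⟨A, C, lam, κ, hκ1, hκ2, hlam, φA, hφA, hapb⟩ := hAPB
  obtain ⟨φU, hφU, huq⟩ := hUQ hPL A C lam κ hκ1 hκ2 hlam
  obtain ⟨φC, hφC, hcl⟩ := hCL s₆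
  refine ⟨min φA (min φU φC), lt_min hφA (lt_min hφU hφC), ?_⟩
  intro Φ ν hcls hM hd
  have hdA : (PointProcess.density ν).toReal < φA := lt_of_lt_of_le hd (min_le_left _ _)
  have hdU : (PointProcess.density ν).toReal < φU :=
    lt_of_lt_of_le hd ((min_le_right _ _).trans (min_le_left _ _))
  have hdC : (PointProcess.density ν).toReal < φC :=
    lt_of_lt_of_le hd ((min_le_right _ _).trans (min_le_right _ _))
  exact hcl Φ ν hcls (huq Φ ν hcls hM (hapb Φ ν hcls hM hdA) hdU) hdC

/-- **`EvenStressEnskog` from S1–S6** and the route items `RateFloor` (stmt-13080), `ParityRigidity` (13084),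
`CollisionTightness` (13085), `HsEosLowDensity` (0768), cited BY NAME: `enskogClassification_of` gives `φ₀` and `C⁺`; the
local-limit reduction S1, fed with it, with S2 and with the four items, returns `η₀` with the crux body, re-folded into the
crux decl by `evenStressEnskog_iff`.  Sorry-free; the statement `Prop`s `Stubs.stub_*` are named like the registered stubs
so that the layer-invariant audit admits them by name. [folklore] -/
theorem EvenStressEnskog_of
    (hS1 : Stubs.stub_localLimitReduction) (hS2 : Stubs.stub_localVelocityEquilibration)
    (hS3 : Stubs.stub_clusterEnvelopes) (hS4 : Stubs.stub_pairLiouville)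
    (hS5 : Stubs.stub_defectHierarchyUniqueness) (hS6 : Stubs.stub_gibbsContactLaw)
    (h₄ : RateFloor) (s₂ : ParityRigidity) (s₃ : CollisionTightness) (s₆ : HsEosLowDensity) :
    EvenStressEnskog := by
  obtain ⟨φ₀, hφ₀, hclass⟩ := enskogClassification_of hS3 hS4 hS5 hS6 s₆
  obtain ⟨η₀, hη₀, h⟩ := hS1 φ₀ hφ₀ hclass hS2 h₄ s₂ s₃ s₆
  exact evenStressEnskog_iff.2 ⟨η₀, hη₀, h⟩

/-- **The skeleton IS the crux proof modulo the registered stubs** (D-0027 §3.3 shape): sorry-free itself; its only gaps are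
the six `stub_*` theorems above (matched by `EvenStressEnskog_of` against the statement `Prop`s `Stubs.stub_*` by
`rfl`-unfolding) and the four route items, which enter by name. [folklore] -/
theorem EvenStressEnskog_proof (h₄ : RateFloor) (s₂ : ParityRigidity) (s₃ : CollisionTightness)
    (s₆ : HsEosLowDensity) : EvenStressEnskog :=
  EvenStressEnskog_of stub_localLimitReduction stub_localVelocityEquilibration stub_clusterEnvelopes
    stub_pairLiouville stub_defectHierarchyUniqueness stub_gibbsContactLaw h₄ s₂ s₃ s₆

end Summit.AtomisticToContinuum.HydrodynamicLimit.Cruxes.EvenStressEnskog.DefectHierarchyZeroDriving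

end
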